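import Literature.AlgebraicGeometry.Resolution.CentresAndCoordinates
import Literature.AlgebraicGeometry.Motives.GeneratingSectionsOfHomAppLE
import Literature.AlgebraicGeometry.Motives.ProjectiveSpaceFunctionField

/-!
# Route RisoStrata — crux `RisoGlobalisation`, line SketchIdeator1: stub `stub_chartRing`

Local rings of a projective model with homogeneous coordinates, on a standard chart.
Let `B` be a projective model of `K/k` with a closed `k`-immersion `ι_B : B ↪ ℙⁿ_k` and
homogeneous coordinates `w ∈ Kⁿ⁺¹ ∖ 0` of its generic point, and let `y ∈ ι_B⁻¹ D₊(x_γ)`.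
Then every element of the local ring `𝒪_{B,y} ⊆ K` (`ProjModel.stalkSubring`) is a quotient
`a · s⁻¹` with `a, s` in the chart ring `k[w_α/w_γ : α] ⊆ K` and `s` a unit of `𝒪_{B,y}`.

Proof: `ι_B` is surjective on stalks (closed immersion); `𝒪_{ℙⁿ, ι_B y}` is the localisation of
`Γ(ℙⁿ, D₊(x_γ)) ≅ (k[x]_{(x_γ)})₀` at `ι_B y` (`IsAffineOpen.isLocalization_stalk`); the composite
character `χ : (k[x]_{(x_γ)})₀ → Γ(ℙⁿ, D₊(x_γ)) → 𝒪_{ℙⁿ,ι_B y} → 𝒪_{B,y} → K` is a `k`-algebra map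
sending `x_α/x_γ` to the generic value of `ι_B^*(x_α/x_γ)`, which is `w_α/w_γ`
(`ofSection_homRatio_eq_div`), so its image is `k[w_α/w_γ]` (`algHom_awayMk_eq_aeval`).
-/

-- single-problem summit: the doubled namespace component `ResolutionOfSingularities` is forced
set_option linter.dupNamespace false

namespace Summit.ResolutionOfSingularities.ResolutionOfSingularities.Theorems

open AlgebraicGeometry CategoryTheory
open Literature.AlgebraicGeometry.Resolution Literature.AlgebraicGeometry.Motives

attribute [local instance] MvPolynomial.gradedAlgebra

universe u

variable {k K : Type u} [Field k] [Field K] [Algebra k K]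

open HomogeneousLocalization TopologicalSpace

/-- A ring map out of the chart ring `(k[x]_{(x_γ)})₀` of `ℙⁿ_k` which is `k`-linear on constants
takes all its values in the `k`-subalgebra generated by the images of the coordinates `x_α/x_γ`
(the chart ring is generated over `k` by the `x_α/x_γ`). -/
theorem chartRing_apply_mem_adjoin {n : ℕ} (γ : Fin (n + 1))
    (χ : Away (Segre.grading (Fin (n + 1)) k) (MvPolynomial.X γ) →+* K)
    (hχ : ∀ c : k, χ (Segre.cst k (MvPolynomial.X γ) c) = algebraMap k K c)
    (q : Away (Segre.grading (Fin (n + 1)) k) (MvPolynomial.X γ)) :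
    χ q ∈ Algebra.adjoin k (Set.range fun α => χ (Segre.frac k γ α)) := by
  letI : Algebra k (Away (Segre.grading (Fin (n + 1)) k) (MvPolynomial.X γ)) :=
    ProjBaseChange.algebraBase _ _
  let χ' : Away (Segre.grading (Fin (n + 1)) k) (MvPolynomial.X γ) →ₐ[k] K :=
    { χ with commutes' := hχ }
  obtain ⟨m, g, hg, rfl⟩ := Away.mk_surjective _ (Segre.X_mem k γ) q
  have h : χ' (Away.mk _ (Segre.X_mem k γ) m g hg) =
      MvPolynomial.aeval (fun α => χ' (ProjectiveSpace.coord γ α)) g :=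
    ProjectiveSpace.algHom_awayMk_eq_aeval γ χ' g hg
  have hfun : (fun α => χ (Segre.frac k γ α)) = fun α => χ' (ProjectiveSpace.coord γ α) :=
    funext fun α => by rw [frac_eq_coord]; rfl
  change χ' _ ∈ _
  rw [h, hfun, Algebra.adjoin_range_eq_range_aeval]
  exact ⟨g, rfl⟩

/-- `𝒪_{B,y} → K` of the germ of a constant `c ∈ k` is `c`. -/
theorem chartRing_stalkToK_germ_cst (B : ProjModel k K) (y : B.X) (c : k) :
    B.stalkToK y (B.X.presheaf.germ ⊤ y trivial (B.π.appTop ((Scheme.ΓSpecIso (.of k)).inv c))) =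
      algebraMap k K c := by
  rw [← B.funFieldIso_hom_algebraMap c]
  change B.funFieldIso.hom.hom (RatFn.toFunctionField y _) = _
  congr 1
  rw [show algebraMap k B.X.functionField c =
      (B.X.presheaf.germ ⊤ (genericPoint B.X) trivial).hom
        (B.π.appTop.hom ((Scheme.ΓSpecIso (.of k)).inv.hom c)) from
      RingHom.congr_fun (ProjModel.algebraMap_functionField_eq_germ B) c]
  change (B.X.presheaf.germ ⊤ y trivial ≫ B.X.presheaf.stalkSpecializes _).hom _ = _
  rw [TopCat.Presheaf.germ_stalkSpecializes]

section Chart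

variable (B : ProjModel k K) {n : ℕ} (ιB : B.X ⟶ Proj (Segre.grading (Fin (n + 1)) k))

/-- On the chart `ι_B⁻¹ D₊(x_γ)`, the pulled-back constant function `c` has germ the germ of the
global constant `c`. -/
theorem chartRing_germ_pull_cst (hιB : ιB ≫ Segre.toSpec (Fin (n + 1)) k = B.π)
    (γ : Fin (n + 1)) (y : B.X) (hy : y ∈ GeneratingSections.preU ιB γ) (c : k) :
    B.X.presheaf.germ (GeneratingSections.preU ιB γ) y hy
        ((GeneratingSections.preU ιB γ).topIso.hom
          (Segre.pull (GeneratingSections.chartLift ιB γ) (Segre.cst k (MvPolynomial.X γ) c))) =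
      B.X.presheaf.germ ⊤ y trivial (B.π.appTop ((Scheme.ΓSpecIso (.of k)).inv c)) := by
  have e : GeneratingSections.chartLift ιB γ ≫
      Spec.map (CommRingCat.ofHom (Segre.cst k (MvPolynomial.X γ))) =
      (GeneratingSections.preU ιB γ).ι ≫ B.π := by
    rw [← Segre.chartι_toSpec, ← Category.assoc, GeneratingSections.chartLift_chartι,
      Category.assoc, hιB]
  have h1 : Segre.pull (GeneratingSections.chartLift ιB γ) (Segre.cst k (MvPolynomial.X γ) c) =
      Segre.pull ((GeneratingSections.preU ιB γ).ι ≫ B.π) c := by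
    rw [← e, Segre.pull_SpecMap']
    rfl
  rw [h1, Segre.pull_comp, RingHom.comp_apply, Segre.pull_apply, Scheme.Opens.topIso_hom_appTop]
  exact TopCat.Presheaf.germ_res_apply B.X.presheaf _ _ _ _

variable (w : Fin (n + 1) → K) (hw : w ≠ 0)
  (hgenB : B.gen ≫ ιB = (ProjectiveSpace.pointOfVec k w hw).left)

include hgenB in
/-- The `K(B)`-point of `ι_B` is the point with homogeneous coordinates `w` read in `K(B) ≅ K`. -/
theorem chartRing_fromSpecStalk_comp :
    B.X.fromSpecStalk (genericPoint B.X) ≫ ιB =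
      (ProjectiveSpace.pointOfVec k (fun l => B.funFieldAlgEquiv.symm (w l))
        (ProjectiveSpace.algHom_comp_ne_zero B.funFieldAlgEquiv.symm.toAlgHom hw)).left := by
  have he : CommRingCat.ofHom (B.funFieldAlgEquiv.symm.toAlgHom : K →+* B.X.functionField) =
      B.funFieldIso.inv := by
    ext b; rfl
  rw [B.fromSpecStalk_genericPoint_eq, Category.assoc, hgenB, ← he]
  exact ProjectiveSpace.specMap_comp_pointOfVec_left B.funFieldAlgEquiv.symm.toAlgHom w hw

include hgenB in
/-- **The generic value of `ι_B^*(x_α/x_γ)` read in `K` is `w_α/w_γ`**: the germ at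
`y ∈ ι_B⁻¹D₊(x_γ)` of the ratio section `homRatio ι_B γ α` maps to `w_α / w_γ` under
`𝒪_{B,y} → K`. -/
theorem chartRing_stalkToK_germ_homRatio (γ α : Fin (n + 1)) (y : B.X)
    (hy : y ∈ GeneratingSections.preU ιB γ) :
    B.stalkToK y (B.X.presheaf.germ (GeneratingSections.preU ιB γ) y hy
      (GeneratingSections.homRatio ιB γ α)) = w α / w γ := by
  have hη : genericPoint B.X ∈ GeneratingSections.preU ιB γ := RatFn.genericPoint_mem_of_mem hy
  have h1 : B.stalkToK y (B.X.presheaf.germ (GeneratingSections.preU ιB γ) y hy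
      (GeneratingSections.homRatio ιB γ α)) =
      B.funFieldIso.hom.hom (RatFn.ofSection hη (GeneratingSections.homRatio ιB γ α)) := by
    rw [RatFn.ofSection_eq_toFunctionField hy]
    rfl
  have hval : ∀ x : K, B.funFieldIso.hom.hom (B.funFieldAlgEquiv.symm x) = x := fun x => by
    rw [ProjModel.funFieldAlgEquiv_symm_apply, ← CommRingCat.comp_apply, Iso.inv_hom_id,
      CommRingCat.id_apply]
  rw [h1, ofSection_homRatio_eq_div _ ιB _ (chartRing_fromSpecStalk_comp B ιB w hw hgenB) hη α,
    map_div₀, hval, hval]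

end Chart

/-- **Local rings of a projective model with homogeneous coordinates, on a standard chart.**
For `B ↪ ℙⁿ_k` a projective model whose generic point has homogeneous coordinates `w`, and a
point `y` of the chart `ι_B⁻¹ D₊(x_γ)`, every element of the local ring `𝒪_{B,y} ⊆ K` is a
quotient `a · s⁻¹` of elements of the chart ring `k[w_α/w_γ] ⊆ K` with `s` invertible in
`𝒪_{B,y}` (the closed immersion is surjective on stalks, `𝒪_{ℙⁿ,ι y}` is the localisation of
`Γ(D₊(x_γ)) = k[x_α/x_γ]`, and `ι^*(x_α/x_γ)` has generic value `w_α/w_γ`,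
tree `ofSection_homRatio_eq_div`). -/
theorem stub_chartRing (B : ProjModel k K) {n : ℕ}
    (ιB : B.X ⟶ Proj (Segre.grading (Fin (n + 1)) k)) [IsClosedImmersion ιB]
    (hιB : ιB ≫ Segre.toSpec (Fin (n + 1)) k = B.π) (w : Fin (n + 1) → K) (hw : w ≠ 0)
    (hgenB : B.gen ≫ ιB = (ProjectiveSpace.pointOfVec k w hw).left)
    (γ : Fin (n + 1)) (y : B.X) (hy : y ∈ GeneratingSections.preU ιB γ)
    (z : K) (hz : z ∈ B.stalkSubring y) :
    ∃ a ∈ Algebra.adjoin k (Set.range fun α => w α * (w γ)⁻¹),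
      ∃ s ∈ Algebra.adjoin k (Set.range fun α => w α * (w γ)⁻¹),
        s⁻¹ ∈ B.stalkSubring y ∧ z = a * s⁻¹ := by
  -- the affine chart `D = D₊(x_γ)` of `ℙⁿ_k` containing `p = ι_B y`
  let D : (Proj (Segre.grading (Fin (n + 1)) k)).Opens :=
    Proj.basicOpen (Segre.grading (Fin (n + 1)) k) (MvPolynomial.X γ)
  have hD : IsAffineOpen D :=
    Proj.isAffineOpen_basicOpen _ _ (Segre.X_mem k γ) zero_lt_one
  have hp : ιB y ∈ D := hy
  -- `z = stalkToK t`, `t = ι_B.stalkMap y t'`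
  obtain ⟨t, rfl⟩ := (B.mem_stalkSubring_iff y).mp hz
  obtain ⟨t', rfl⟩ := ιB.stalkMap_surjective y t
  -- `𝒪_{ℙⁿ, p}` is the localisation of `Γ(ℙⁿ, D)` at `p`: `t' · germ b = germ a`
  letI := (Proj (Segre.grading (Fin (n + 1)) k)).presheaf.algebra_section_stalk (⟨ιB y, hp⟩ : D)
  haveI : IsLocalization.AtPrime ((Proj (Segre.grading (Fin (n + 1)) k)).presheaf.stalk (ιB y))
      (hD.primeIdealOf ⟨ιB y, hp⟩).asIdeal := hD.isLocalization_stalk ⟨ιB y, hp⟩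
  obtain ⟨⟨a, b⟩, hab⟩ :=
    IsLocalization.surj (hD.primeIdealOf ⟨ιB y, hp⟩).asIdeal.primeCompl t'
  have hbu : IsUnit (algebraMap Γ(Proj (Segre.grading (Fin (n + 1)) k), D)
      ((Proj (Segre.grading (Fin (n + 1)) k)).presheaf.stalk (ιB y)) b) :=
    IsLocalization.map_units _ b
  -- the character `χ : Γ(ℙⁿ, D) → 𝒪_{ℙⁿ,p} → 𝒪_{B,y} → K`
  let F : ((Proj (Segre.grading (Fin (n + 1)) k)).presheaf.stalk (ιB y) : Type u) →+* K :=
    (B.stalkToK y).comp (ιB.stalkMap y).hom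
  let χ : (Γ(Proj (Segre.grading (Fin (n + 1)) k), D) : Type u) →+* K :=
    F.comp ((Proj (Segre.grading (Fin (n + 1)) k)).presheaf.germ D (ιB y) hp).hom
  have hχ : ∀ q, χ (Proj.awayToSection _ (MvPolynomial.X γ) q) =
      B.stalkToK y (B.X.presheaf.germ (GeneratingSections.preU ιB γ) y hy
        ((GeneratingSections.preU ιB γ).topIso.hom
          (Segre.pull (GeneratingSections.chartLift ιB γ) q))) := fun q => by
    rw [GeneratingSections.topIso_hom_pull_chartLift, ← Scheme.Hom.app_eq_appLE,
      ← Scheme.Hom.germ_stalkMap_apply]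
    rfl
  -- `χ` is `k`-linear and sends `x_α/x_γ` to `w_α/w_γ`, so takes values in `k[w_α/w_γ]`
  let χ' : Away (Segre.grading (Fin (n + 1)) k) (MvPolynomial.X γ) →+* K :=
    χ.comp (Proj.awayToSection _ (MvPolynomial.X γ)).hom
  have hcst : ∀ c : k, χ' (Segre.cst k (MvPolynomial.X γ) c) = algebraMap k K c := fun c => by
    change χ (Proj.awayToSection _ (MvPolynomial.X γ) _) = _
    rw [hχ, chartRing_germ_pull_cst B ιB hιB γ y hy c, chartRing_stalkToK_germ_cst]
  have hfrac : (fun α => χ' (Segre.frac k γ α)) = fun α => w α * (w γ)⁻¹ := funext fun α => by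
    change χ (Proj.awayToSection _ (MvPolynomial.X γ) _) = _
    rw [hχ, ← div_eq_mul_inv]
    exact chartRing_stalkToK_germ_homRatio B ιB w hw hgenB γ α y hy
  have hmem : ∀ s, χ s ∈ Algebra.adjoin k (Set.range fun α => w α * (w γ)⁻¹) := fun s => by
    obtain ⟨q, rfl⟩ := (Proj.basicOpenIsoAway _ (MvPolynomial.X γ) (Segre.X_mem k γ)
      zero_lt_one).commRingCatIsoToRingEquiv.surjective s
    rw [← hfrac]
    exact chartRing_apply_mem_adjoin γ χ' hcst q
  -- units: `germ b` is a unit of `𝒪_{ℙⁿ,p}`, so `χ b` is the image of a unit of `𝒪_{B,y}`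
  obtain ⟨u, hu⟩ := hbu.map (ιB.stalkMap y).hom
  have hχb : χ b = B.stalkToK y u := by rw [hu]; rfl
  have hχb0 : χ b ≠ 0 := by
    rw [hχb]
    exact (map_ne_zero_iff _ (B.stalkToK_injective y)).mpr u.ne_zero
  refine ⟨χ a, hmem a, χ b, hmem b, ?_, ?_⟩
  · rw [hχb, ← map_units_inv]
    exact B.stalkToK_mem y _
  · rw [eq_mul_inv_iff_mul_eq₀ hχb0]
    have h := congrArg F hab
    rw [map_mul] at h
    exact h

end Summit.ResolutionOfSingularities.ResolutionOfSingularities.Theorems
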